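import Mathlib

/-!
# SoloBlind — the dominant tridiagonal tail: bounded solutions, the tail value and its seed bounds (J-TAIL, part 1)

ENGINE L folds the semi-infinite streak/roll chains at a row `n₀` and needs the value
`t = a_K · (inverse of the tail block)₀₀` of the continued-fraction tail at a SEED depth `K = n₀ + KTAIL`,
where the rows are strongly dominant (`‖β_k‖ ≥ b ≫ ‖a_k‖ + ‖c_k‖`, since `Im β_k ∼ g⁴ k²`).  This file is the
sequence-space theory of such a tail, on bounded sequences `ℕ →ᵇ ℂ`:

* `IsSol a β c r y` — `y` solves the rows `a j · y (j-1) - β j · y j + c j · y (j+1) = r j` (`j ≥ 0`, no `a 0` coupling);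
* `Dominant a β c b q` — `0 < b ≤ ‖β j‖`, `‖a j‖ + ‖c j‖ ≤ q ‖β j‖`, `q < 1`;
* uniqueness of bounded solutions (`sub_eq_zero_of_bounded`, a maximum principle), existence by the contraction
  `Φ_r y = (a·prev y + c·next y - r)/β` on `ℕ →ᵇ ℂ` (`sol`, `isSol_sol`), the a-priori bound `‖sol r‖ ≤ ‖r‖/(b(1-q))`
  (`norm_sol_le`), and `eq_sol_of_isSol` (any bounded solution is `sol r`);
* the TAIL VALUE `tval = -(a 0) · (sol δ₀) 0` with the seed ball `‖tval‖ ≤ ‖a 0‖/(b(1-q))` (`norm_tval_le`) and the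
  perturbation bound `‖tval - tval'‖ ≤ ‖a 0‖ · (sup ‖β-β'‖) /(b(1-q))²` for two dominant diagonals with the same `a, c`
  (`norm_tval_sub_le`) — the seed radius and the seed Lipschitz constant `lip0` of engine v1.2l `tail_ball`/`tail_lip_rec`.

The fold identity (the finite folded system reproduces the top block of the bounded solution) is part 2.
-/

namespace Summit.AnomalousDissipation.SoloBlind.TailOperator

open BoundedContinuousFunction

/-- The previous entry, with the convention `prev y 0 = 0` (the tail has no coupling above its first row). -/
def prev (y : ℕ → ℂ) : ℕ → ℂ
  | 0 => 0
  | j + 1 => y j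

/-- `prev y 0 = 0`. -/
@[simp] theorem prev_zero (y : ℕ → ℂ) : prev y 0 = 0 := rfl
/-- `prev y (j+1) = y j`. -/
@[simp] theorem prev_succ (y : ℕ → ℂ) (j : ℕ) : prev y (j + 1) = y j := rfl

/-- `prev` is additive: `prev y - prev y' = prev (y - y')`. -/
theorem prev_sub (y y' : ℕ → ℂ) (j : ℕ) : prev y j - prev y' j = prev (fun i => y i - y' i) j := by
  cases j <;> simp [prev]

/-- A uniform bound on `y` bounds `prev y`. -/
theorem norm_prev_le {y : ℕ → ℂ} {B : ℝ} (hB : 0 ≤ B) (h : ∀ j, ‖y j‖ ≤ B) (j : ℕ) : ‖prev y j‖ ≤ B := by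
  cases j <;> simp [prev, hB, h]

/-- `y` solves the tridiagonal tail system with right-hand side `r`. -/
def IsSol (a β c : ℕ → ℂ) (r y : ℕ → ℂ) : Prop :=
  ∀ j, a j * prev y j - β j * y j + c j * y (j + 1) = r j

/-- Row dominance of the tail: `0 < b ≤ ‖β j‖` and `‖a j‖ + ‖c j‖ ≤ q ‖β j‖` with `0 ≤ q < 1`. -/
structure Dominant (a β c : ℕ → ℂ) (b q : ℝ) : Prop where
  b_pos : 0 < b
  q_nonneg : 0 ≤ q
  q_lt : q < 1
  beta_ge : ∀ j, b ≤ ‖β j‖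
  ac_le : ∀ j, ‖a j‖ + ‖c j‖ ≤ q * ‖β j‖

variable {a β c : ℕ → ℂ} {b q : ℝ}

/-- Dominant diagonals have positive norm. -/
theorem Dominant.beta_pos (hD : Dominant a β c b q) (j : ℕ) : 0 < ‖β j‖ := lt_of_lt_of_le hD.b_pos (hD.beta_ge j)

/-- Dominant diagonals are nonzero. -/
theorem Dominant.beta_ne (hD : Dominant a β c b q) (j : ℕ) : β j ≠ 0 := norm_pos_iff.mp (hD.beta_pos j)

/-- The basic row estimate: if `y` solves the system with right-hand side `r` and `‖prev y j‖, ‖y (j+1)‖ ≤ B`, then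
`‖y j‖ ≤ q B + ‖r j‖/‖β j‖`. -/
theorem row_estimate (hD : Dominant a β c b q) {r y : ℕ → ℂ} (hy : IsSol a β c r y) {B : ℝ} (hB : 0 ≤ B)
    (j : ℕ) (hp : ‖prev y j‖ ≤ B) (hn : ‖y (j + 1)‖ ≤ B) : ‖y j‖ ≤ q * B + ‖r j‖ / ‖β j‖ := by
  have hβ := hD.beta_pos j
  have e : β j * y j = a j * prev y j + c j * y (j + 1) - r j := by
    have := hy j; linear_combination -this
  have h1 : ‖β j‖ * ‖y j‖ ≤ (‖a j‖ + ‖c j‖) * B + ‖r j‖ := by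
    rw [← norm_mul, e]
    calc ‖a j * prev y j + c j * y (j + 1) - r j‖ ≤ ‖a j * prev y j‖ + ‖c j * y (j + 1)‖ + ‖r j‖ := by
            have := norm_add_le (a j * prev y j) (c j * y (j + 1))
            have := norm_sub_le (a j * prev y j + c j * y (j + 1)) (r j); linarith
      _ ≤ ‖a j‖ * B + ‖c j‖ * B + ‖r j‖ := by
            rw [norm_mul, norm_mul]
            gcongr
      _ = (‖a j‖ + ‖c j‖) * B + ‖r j‖ := by ring
  have h2 : (‖a j‖ + ‖c j‖) * B ≤ q * ‖β j‖ * B := mul_le_mul_of_nonneg_right (hD.ac_le j) hB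
  have h3 : ‖β j‖ * ‖y j‖ ≤ ‖β j‖ * (q * B + ‖r j‖ / ‖β j‖) := by
    rw [mul_add, mul_div_cancel₀ _ (ne_of_gt hβ)]; nlinarith
  exact le_of_mul_le_mul_left h3 hβ

/-- **Maximum principle / uniqueness**: a bounded solution of the homogeneous dominant system vanishes. -/
theorem eq_zero_of_bounded (hD : Dominant a β c b q) {y : ℕ → ℂ} (hy : IsSol a β c 0 y) {B : ℝ}
    (h : ∀ j, ‖y j‖ ≤ B) : y = 0 := by
  have hB : 0 ≤ B := le_trans (norm_nonneg _) (h 0)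
  -- the supremum s of ‖y j‖ satisfies s ≤ q s
  set s := ⨆ j, ‖y j‖ with hs
  have hbdd : BddAbove (Set.range fun j => ‖y j‖) := ⟨B, by rintro _ ⟨j, rfl⟩; exact h j⟩
  have hle : ∀ j, ‖y j‖ ≤ s := fun j => le_ciSup hbdd j
  have hs0 : 0 ≤ s := le_trans (norm_nonneg _) (hle 0)
  have hq : ∀ j, ‖y j‖ ≤ q * s := by
    intro j
    have := row_estimate hD hy hs0 j (norm_prev_le hs0 hle j) (hle (j + 1))
    simpa using this
  have hss : s ≤ q * s := ciSup_le hq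
  have hs' : s ≤ 0 := by nlinarith [hD.q_lt]
  funext j
  have : ‖y j‖ ≤ 0 := le_trans (hle j) hs'
  simpa using le_antisymm this (norm_nonneg _)

/-- Two bounded solutions with the same right-hand side coincide. -/
theorem sub_eq_zero_of_bounded (hD : Dominant a β c b q) {r y y' : ℕ → ℂ} (hy : IsSol a β c r y)
    (hy' : IsSol a β c r y') {B B' : ℝ} (h : ∀ j, ‖y j‖ ≤ B) (h' : ∀ j, ‖y' j‖ ≤ B') : y = y' := by
  have hd : IsSol a β c 0 (fun j => y j - y' j) := by
    intro j
    have e1 := hy j; have e2 := hy' j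
    rw [← prev_sub]
    simp only [Pi.zero_apply]
    linear_combination e1 - e2
  have := eq_zero_of_bounded hD hd (B := B + B') (fun j => by
    calc ‖y j - y' j‖ ≤ ‖y j‖ + ‖y' j‖ := norm_sub_le _ _
      _ ≤ B + B' := add_le_add (h j) (h' j))
  funext j
  have := congrFun this j
  simpa [sub_eq_zero] using this

/-! ### Existence by contraction on `ℕ →ᵇ ℂ` -/

/-- The pointwise fixed-point map `Φ_r y = (a · prev y + c · next y - r)/β`. -/
noncomputable def phiFun (a β c : ℕ → ℂ) (r y : ℕ → ℂ) (j : ℕ) : ℂ :=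
  (a j * prev y j + c j * y (j + 1) - r j) / β j

/-- `Φ_r` maps bounded sequences to bounded sequences: `‖Φ_r y j‖ ≤ q‖y‖ + ‖r‖/b`. -/
theorem norm_phiFun_le (hD : Dominant a β c b q) (r y : ℕ →ᵇ ℂ) (j : ℕ) :
    ‖phiFun a β c r y j‖ ≤ q * ‖y‖ + ‖r‖ / b := by
  have hβ := hD.beta_pos j
  unfold phiFun
  rw [norm_div]
  have hy : ∀ i, ‖y i‖ ≤ ‖y‖ := fun i => y.norm_coe_le_norm i
  have h1 : ‖a j * prev (⇑y) j + c j * y (j + 1) - r j‖ ≤ (‖a j‖ + ‖c j‖) * ‖y‖ + ‖r‖ := by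
    calc ‖a j * prev (⇑y) j + c j * y (j + 1) - r j‖ ≤ ‖a j * prev (⇑y) j‖ + ‖c j * y (j + 1)‖ + ‖r j‖ := by
            have := norm_add_le (a j * prev (⇑y) j) (c j * y (j + 1))
            have := norm_sub_le (a j * prev (⇑y) j + c j * y (j + 1)) (r j); linarith
      _ ≤ ‖a j‖ * ‖y‖ + ‖c j‖ * ‖y‖ + ‖r‖ := by
            rw [norm_mul, norm_mul]
            gcongr
            · exact norm_prev_le (norm_nonneg _) hy j
            · exact hy (j + 1)
            · exact r.norm_coe_le_norm j
      _ = (‖a j‖ + ‖c j‖) * ‖y‖ + ‖r‖ := by ring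
  calc ‖a j * prev (⇑y) j + c j * y (j + 1) - r j‖ / ‖β j‖ ≤ ((‖a j‖ + ‖c j‖) * ‖y‖ + ‖r‖) / ‖β j‖ :=
        div_le_div_of_nonneg_right h1 hβ.le
    _ = (‖a j‖ + ‖c j‖) / ‖β j‖ * ‖y‖ + ‖r‖ / ‖β j‖ := by ring
    _ ≤ q * ‖y‖ + ‖r‖ / b := by
        gcongr
        · rw [div_le_iff₀ hβ]; exact hD.ac_le j
        · exact hD.b_pos
        · exact hD.beta_ge j

/-- `Φ_r` as a self-map of the Banach space `ℕ →ᵇ ℂ`. -/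
noncomputable def Phi (hD : Dominant a β c b q) (r : ℕ →ᵇ ℂ) (y : ℕ →ᵇ ℂ) : ℕ →ᵇ ℂ :=
  ofNormedAddCommGroupDiscrete (phiFun a β c r y) (q * ‖y‖ + ‖r‖ / b) (norm_phiFun_le hD r y)

/-- Pointwise value of `Phi`. -/
@[simp] theorem Phi_apply (hD : Dominant a β c b q) (r y : ℕ →ᵇ ℂ) (j : ℕ) :
    Phi hD r y j = phiFun a β c r y j := rfl

/-- `Φ_r` is a `q`-contraction of `ℕ →ᵇ ℂ`. -/
theorem dist_Phi_le (hD : Dominant a β c b q) (r y y' : ℕ →ᵇ ℂ) :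
    dist (Phi hD r y) (Phi hD r y') ≤ q * dist y y' := by
  have hq0 : 0 ≤ q * dist y y' := mul_nonneg hD.q_nonneg dist_nonneg
  rw [dist_le hq0]
  intro j
  have hβ := hD.beta_pos j
  rw [dist_eq_norm, Phi_apply, Phi_apply]
  unfold phiFun
  rw [← sub_div, norm_div]
  have hdy : ∀ i, ‖y i - y' i‖ ≤ dist y y' := fun i => by rw [← dist_eq_norm]; exact dist_coe_le_dist i
  have e : a j * prev (⇑y) j + c j * y (j + 1) - r j - (a j * prev (⇑y') j + c j * y' (j + 1) - r j) =
      a j * prev (fun i => y i - y' i) j + c j * (y (j + 1) - y' (j + 1)) := by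
    rw [← prev_sub]; ring
  rw [e]
  have h1 : ‖a j * prev (fun i => y i - y' i) j + c j * (y (j + 1) - y' (j + 1))‖ ≤ (‖a j‖ + ‖c j‖) * dist y y' := by
    calc _ ≤ ‖a j * prev (fun i => y i - y' i) j‖ + ‖c j * (y (j + 1) - y' (j + 1))‖ := norm_add_le _ _
      _ ≤ ‖a j‖ * dist y y' + ‖c j‖ * dist y y' := by
          rw [norm_mul, norm_mul]
          gcongr
          · exact norm_prev_le dist_nonneg hdy j
          · exact hdy (j + 1)
      _ = (‖a j‖ + ‖c j‖) * dist y y' := by ring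
  calc _ ≤ (‖a j‖ + ‖c j‖) * dist y y' / ‖β j‖ := div_le_div_of_nonneg_right h1 hβ.le
    _ = (‖a j‖ + ‖c j‖) / ‖β j‖ * dist y y' := by ring
    _ ≤ q * dist y y' := by
        gcongr
        rw [div_le_iff₀ hβ]; exact hD.ac_le j

/-- The contraction constant as a nonnegative real. -/
noncomputable def qNN (hD : Dominant a β c b q) : NNReal := ⟨q, hD.q_nonneg⟩

/-- `Φ_r` is `ContractingWith q`. -/
theorem contracting_Phi (hD : Dominant a β c b q) (r : ℕ →ᵇ ℂ) : ContractingWith (qNN hD) (Phi hD r) := by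
  refine ⟨?_, LipschitzWith.of_dist_le_mul fun y y' => ?_⟩
  · show (⟨q, hD.q_nonneg⟩ : NNReal) < 1
    exact_mod_cast hD.q_lt
  · exact dist_Phi_le hD r y y'

/-- THE bounded solution of the dominant tail system with bounded right-hand side `r`. -/
noncomputable def sol (hD : Dominant a β c b q) (r : ℕ →ᵇ ℂ) : ℕ →ᵇ ℂ :=
  ContractingWith.fixedPoint (Phi hD r) (contracting_Phi hD r)

/-- `sol r` is a fixed point of `Φ_r`. -/
theorem Phi_sol (hD : Dominant a β c b q) (r : ℕ →ᵇ ℂ) : Phi hD r (sol hD r) = sol hD r :=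
  (contracting_Phi hD r).fixedPoint_isFixedPt

/-- `sol r` solves the system. -/
theorem isSol_sol (hD : Dominant a β c b q) (r : ℕ →ᵇ ℂ) : IsSol a β c r (sol hD r) := by
  intro j
  have h := congrArg (fun f : ℕ →ᵇ ℂ => f j) (Phi_sol hD r)
  simp only [Phi_apply, phiFun] at h
  have hβ := hD.beta_ne j
  rw [div_eq_iff hβ] at h
  linear_combination h

/-- A-priori bound `‖sol r‖ ≤ (‖r‖/b)/(1-q)`. -/
theorem norm_sol_le (hD : Dominant a β c b q) (r : ℕ →ᵇ ℂ) : ‖sol hD r‖ ≤ ‖r‖ / b / (1 - q) := by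
  have h := (contracting_Phi hD r).dist_fixedPoint_le 0
  have h0 : dist (0 : ℕ →ᵇ ℂ) (Phi hD r 0) ≤ ‖r‖ / b := by
    rw [dist_comm, dist_zero_right, norm_le (div_nonneg (norm_nonneg _) hD.b_pos.le)]
    intro j
    have := norm_phiFun_le hD r 0 j
    simpa using this
  have hq1 : (0 : ℝ) < 1 - q := by linarith [hD.q_lt]
  calc ‖sol hD r‖ = dist 0 (sol hD r) := by rw [dist_comm, dist_zero_right]
    _ ≤ dist 0 (Phi hD r 0) / (1 - (qNN hD : ℝ)) := h
    _ = dist 0 (Phi hD r 0) / (1 - q) := rfl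
    _ ≤ ‖r‖ / b / (1 - q) := div_le_div_of_nonneg_right h0 hq1.le

/-- Any bounded solution is `sol r`. -/
theorem eq_sol_of_isSol (hD : Dominant a β c b q) (r : ℕ →ᵇ ℂ) {y : ℕ → ℂ} (hy : IsSol a β c r y) {B : ℝ}
    (h : ∀ j, ‖y j‖ ≤ B) : y = sol hD r :=
  sub_eq_zero_of_bounded hD hy (isSol_sol hD r) h (fun j => (sol hD r).norm_coe_le_norm j)

/-! ### The tail value and its seed bounds -/

/-- The unit right-hand side `δ₀`. -/
noncomputable def delta0 : ℕ →ᵇ ℂ :=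
  ofNormedAddCommGroupDiscrete (fun j => if j = 0 then (1 : ℂ) else 0) 1 (fun j => by split_ifs <;> simp)

/-- Pointwise value of `δ₀`. -/
@[simp] theorem delta0_apply (j : ℕ) : delta0 j = if j = 0 then (1 : ℂ) else 0 := rfl

/-- `‖δ₀‖ ≤ 1`. -/
theorem norm_delta0_le : ‖delta0‖ ≤ 1 := by
  rw [norm_le zero_le_one]; intro j; rw [delta0_apply]; split_ifs <;> simp

/-- The TAIL VALUE `t = -a₀ · (bounded solution of the system with right-hand side δ₀)₀`; it satisfies
`t = a₀/(β₀ - c₀ t⁽¹⁾)` with `t⁽¹⁾` the tail value of the shifted system (part 2), and enters the fold row as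
`β_{n₀-1} ↦ β_{n₀-1} - c_{n₀-1} t`. -/
noncomputable def tval (hD : Dominant a β c b q) : ℂ := -(a 0) * sol hD delta0 0

/-- SEED BALL: `‖t‖ ≤ ‖a 0‖ / (b (1-q))`. -/
theorem norm_tval_le (hD : Dominant a β c b q) : ‖tval hD‖ ≤ ‖a 0‖ * (1 / b / (1 - q)) := by
  unfold tval
  rw [norm_mul, norm_neg]
  gcongr
  calc ‖sol hD delta0 0‖ ≤ ‖sol hD delta0‖ := (sol hD delta0).norm_coe_le_norm 0
    _ ≤ ‖delta0‖ / b / (1 - q) := norm_sol_le hD delta0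
    _ ≤ 1 / b / (1 - q) := by
        have hq1 : (0 : ℝ) < 1 - q := by linarith [hD.q_lt]
        exact div_le_div_of_nonneg_right (div_le_div_of_nonneg_right norm_delta0_le hD.b_pos.le) hq1.le

/-- Perturbation of the diagonal: if `β, β'` are both dominant with the same `a, c, b, q` and `‖β j - β' j‖ ≤ s`
for all `j`, the bounded solutions for `δ₀` differ by at most `s/(b(1-q))²` in norm. -/
theorem norm_sol_sub_sol_le {β' : ℕ → ℂ} (hD : Dominant a β c b q) (hD' : Dominant a β' c b q) {s : ℝ}
    (hs0 : 0 ≤ s) (hs : ∀ j, ‖β j - β' j‖ ≤ s) :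
    ‖sol hD delta0 - sol hD' delta0‖ ≤ s * (1 / b / (1 - q)) * (1 / b / (1 - q)) := by
  set y := sol hD delta0 with hy
  set y' := sol hD' delta0 with hy'
  have hq1 : (0 : ℝ) < 1 - q := by linarith [hD.q_lt]
  have hY' : ‖y'‖ ≤ 1 / b / (1 - q) := by
    calc ‖y'‖ ≤ ‖delta0‖ / b / (1 - q) := norm_sol_le hD' delta0
      _ ≤ 1 / b / (1 - q) :=
          div_le_div_of_nonneg_right (div_le_div_of_nonneg_right norm_delta0_le hD.b_pos.le) hq1.le
  -- the right-hand side (β - β') y' as a bounded function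
  let ρ : ℕ →ᵇ ℂ := ofNormedAddCommGroupDiscrete (fun j => (β j - β' j) * y' j) (s * ‖y'‖) (fun j => by
    rw [norm_mul]; exact mul_le_mul (hs j) (y'.norm_coe_le_norm j) (norm_nonneg _) hs0)
  have hρ : ‖ρ‖ ≤ s * ‖y'‖ := by
    rw [norm_le (mul_nonneg hs0 (norm_nonneg _))]; intro j
    show ‖(β j - β' j) * y' j‖ ≤ s * ‖y'‖
    rw [norm_mul]; exact mul_le_mul (hs j) (y'.norm_coe_le_norm j) (norm_nonneg _) hs0
  -- y - y' solves the β-system with right-hand side ρ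
  have hd : IsSol a β c ρ (fun j => y j - y' j) := by
    intro j
    have e1 := isSol_sol hD delta0 j
    have e2 := isSol_sol hD' delta0 j
    rw [← prev_sub]
    show a j * (prev (⇑y) j - prev (⇑y') j) - β j * (y j - y' j) + c j * (y (j + 1) - y' (j + 1)) = (β j - β' j) * y' j
    rw [← hy] at e1; rw [← hy'] at e2
    linear_combination e1 - e2
  have heq := eq_sol_of_isSol hD ρ hd (B := ‖y‖ + ‖y'‖) (fun j => by
    calc ‖y j - y' j‖ ≤ ‖y j‖ + ‖y' j‖ := norm_sub_le _ _
      _ ≤ ‖y‖ + ‖y'‖ := add_le_add (y.norm_coe_le_norm j) (y'.norm_coe_le_norm j))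
  have hfun : (y - y' : ℕ →ᵇ ℂ) = sol hD ρ := by
    ext j; have := congrFun heq j; simpa using this
  rw [hfun]
  calc ‖sol hD ρ‖ ≤ ‖ρ‖ / b / (1 - q) := norm_sol_le hD ρ
    _ ≤ s * ‖y'‖ / b / (1 - q) :=
        div_le_div_of_nonneg_right (div_le_div_of_nonneg_right hρ hD.b_pos.le) hq1.le
    _ = s * ‖y'‖ * (1 / b / (1 - q)) := by field_simp
    _ ≤ s * (1 / b / (1 - q)) * (1 / b / (1 - q)) := by
        have h0 : 0 ≤ 1 / b / (1 - q) := div_nonneg (div_nonneg zero_le_one hD.b_pos.le) hq1.le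
        calc s * ‖y'‖ * (1 / b / (1 - q)) ≤ s * (1 / b / (1 - q)) * (1 / b / (1 - q)) := by
              gcongr

/-- SEED LIPSCHITZ CONSTANT: `‖t - t'‖ ≤ ‖a 0‖ · s /(b(1-q))²` for two dominant diagonals `β, β'` with
`‖β j - β' j‖ ≤ s` (e.g. `β' = β + μ`, `‖μ‖ ≤ s`: the cell shift of ENGINE L) — `lip0 = ‖a 0‖/(b(1-q))²`. -/
theorem norm_tval_sub_le {β' : ℕ → ℂ} (hD : Dominant a β c b q) (hD' : Dominant a β' c b q) {s : ℝ}
    (hs0 : 0 ≤ s) (hs : ∀ j, ‖β j - β' j‖ ≤ s) :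
    ‖tval hD - tval hD'‖ ≤ ‖a 0‖ * (s * (1 / b / (1 - q)) * (1 / b / (1 - q))) := by
  unfold tval
  have e : -(a 0) * sol hD delta0 0 - -(a 0) * sol hD' delta0 0 = -(a 0) * ((sol hD delta0 - sol hD' delta0) 0) := by
    simp only [BoundedContinuousFunction.coe_sub, Pi.sub_apply]; ring
  rw [e, norm_mul, norm_neg]
  gcongr
  exact le_trans ((sol hD delta0 - sol hD' delta0).norm_coe_le_norm 0) (norm_sol_sub_sol_le hD hD' hs0 hs)

/-- Dominance is stable under a diagonal shift of size `≤ s < b(1-q)… `: if `‖β j‖ ≥ b` and `‖a j‖+‖c j‖ ≤ q b` then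
`β + μ` with `‖μ‖ ≤ s < b` is dominant with constants `(b - s, q b/(b - s))` provided `q b < b - s`. -/
theorem dominant_shift (hb : 0 < b) (hq0 : 0 ≤ q) (hβ : ∀ j, b ≤ ‖β j‖) (hac : ∀ j, ‖a j‖ + ‖c j‖ ≤ q * b)
    {μ : ℂ} {s : ℝ} (hμ : ‖μ‖ ≤ s) (hs : q * b < b - s) :
    Dominant a (fun j => β j + μ) c (b - s) (q * b / (b - s)) := by
  have hbs : 0 < b - s := lt_of_le_of_lt (mul_nonneg hq0 hb.le) hs
  have hβ' : ∀ j, b - s ≤ ‖β j + μ‖ := fun j => by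
    have := norm_sub_norm_le (β j) (-μ)
    rw [sub_neg_eq_add, norm_neg] at this
    linarith [hβ j]
  refine ⟨hbs, div_nonneg (mul_nonneg hq0 hb.le) hbs.le, (div_lt_one hbs).mpr hs, hβ', fun j => ?_⟩
  calc ‖a j‖ + ‖c j‖ ≤ q * b := hac j
    _ = q * b / (b - s) * (b - s) := by field_simp
    _ ≤ q * b / (b - s) * ‖β j + μ‖ :=
        mul_le_mul_of_nonneg_left (hβ' j) (div_nonneg (mul_nonneg hq0 hb.le) hbs.le)

end Summit.AnomalousDissipation.SoloBlind.TailOperator
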